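import Mathlib
import Summits.Ventures.PercRepro2.Defs
import Summits.Ventures.PercRepro2.Graph
import Summits.Ventures.PercRepro2.Events
import Summits.Ventures.PercRepro2.Harris
import Summits.Ventures.PercRepro2.Induced
import Summits.Ventures.PercRepro2.SeedSet
import Summits.Ventures.PercRepro2.BHKEvents
import Summits.Ventures.PercRepro2.CrossRootT

/-!
# Row 2′MM0 (MM0⁻) for the ONE-SIDED gate: a theorem (blind cell PercRepro2, night-1 g2;
`proofs/NIGHT1-MM0.md` §2 (T5))

The free-edge gate `{s ↮ t in H + uw}` becomes a pure avoidance event when the endpoint `w` is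
glued to `t` (`w` adjacent to `t` by a deterministic edge): `gate′ = {s ↮ t, s ↮ u} = {S avoids {t, u}}`
and `{v ↔ t in H + uw}` becomes `{v ∈ C({t, u})}`, the cluster of the SEED SET `{t, u}`.  The
statement (MM0⁻) of record (lead, INBOX 2026-08-23T23:12:20Z) then reads, with the H-level centrings
`ȳ = P(b ∈ C(s) | s ↮ t)` and `c = P(v ∈ C(t) | s ↮ t)`,

  `E[(1[b ∈ C(s)] − ȳ) · (1[v ∈ C({t,u})] − c); S avoids {t, u}] ≤ 0`   (`oneSided_nonpos`).

Cleared (`a = P(s ↮ t)`, `g = P(S av {t,u})`, `Y_R, Z_R` the `R`-masses, `Y_G, Z_G, YZ_G` the gate masses):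
`F = a²·YZ_G − a·Y_R·Z_G − a·Z_R·Y_G + Y_R·Z_R·g ≤ 0`.  Proof: the identity
`g·F = −a²·(Y_G·Z_G − g·YZ_G) + (a·Y_G − g·Y_R)·(a·Z_G − g·Z_R)` and three landed BHK06 forms —
(i) the cross-cluster inequality for the seed set `{t, u}` against the root `s` (`bhk_cross_clusterT`):
`Y_G·Z_G ≥ g·YZ_G`; (ii) the same-cluster positive association of `C(s)` given `s ↮ t` for `{b ∈ ·}`,
`{u ∈ ·}` (`bhk_same_cluster_events`): `E[y | S av {t,u}] ≤ E[y | S av t]`, i.e. `a·Y_G ≤ g·Y_R`;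
(iii) the cross-cluster inequality `{u ∈ C(s)}` against `{v ∈ C(t)}` given `s ↮ t`
(`bhk_cross_cluster`) plus `{v ∈ C(t)} ⊆ {v ∈ C({t,u})}`: `P(v ∈ C({t,u}) | S av {t,u}) ≥ c`, i.e.
`a·Z_G ≥ g·Z_R`.  So both shifts have DEFINITE signs here — exactly what the general (mixed) gate
lacks (`MM0GateBHK.lean`: there the shift product has no sign and must be paid by the BHK slack).
-/

namespace Summit.Ventures.PercRepro2
namespace MM0OneSided

variable {V : Type*} {E : Type*} [Fintype E] [DecidableEq E] [Fintype V] [DecidableEq V]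
  {R : Type*} [CommRing R] [LinearOrder R] [IsStrictOrderedRing R]

section Events

variable (ends : E → Sym2 V)

omit [Fintype E] [DecidableEq E] [Fintype V] in
/-- `{S avoids {t, u}} = {s ↮ t} ∩ {s ↮ u}`. -/
lemma avoidAll_pair_eq (s t u : V) :
    avoidAll ends s {t, u} = (connEvent ends s t)ᶜ ∩ (connEvent ends s u)ᶜ := by
  ext ω
  simp only [avoidAll, Set.mem_setOf_eq, Finset.mem_insert, Finset.mem_singleton, forall_eq_or_imp,
    forall_eq, Set.mem_inter_iff, Set.mem_compl_iff, mem_connEvent]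

omit [Fintype E] [DecidableEq E] [Fintype V] in
/-- The seed set `{t, u}` avoids `s` iff `S` avoids `{t, u}`. -/
lemma avoidAllT_pair_eq (s t u : V) :
    avoidAllT ends {t, u} {s} = avoidAll ends s {t, u} := by
  ext ω
  simp only [avoidAllT, avoidAll, Set.mem_setOf_eq, Finset.mem_insert, Finset.mem_singleton,
    forall_eq_or_imp, forall_eq]
  constructor
  · rintro ⟨ht, hu⟩
    exact ⟨fun h => ht (conn_symm h), fun h => hu (conn_symm h)⟩
  · rintro ⟨ht, hu⟩
    exact ⟨fun h => ht (conn_symm h), fun h => hu (conn_symm h)⟩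

omit [Fintype E] [DecidableEq E] [Fintype V] [DecidableEq V] in
/-- `{C(x) ∋ v}` is the connection event `{x ↔ v}`. -/
lemma clusterInEvent_mem_eq (x v : V) :
    clusterInEvent ends x {W | v ∈ W} = connEvent ends x v := by
  ext ω
  simp only [mem_clusterInEvent, Set.mem_setOf_eq, cluster, mem_connEvent]

omit [Fintype E] [DecidableEq E] [Fintype V] [DecidableEq V] in
/-- The family of vertex sets containing `v` is an up-set. -/
lemma isUpperSet_mem (v : V) : IsUpperSet {W : Set V | v ∈ W} := fun _ _ h hW => h hW

omit [Fintype E] [DecidableEq E] [Fintype V] in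
/-- `{v ∈ C(t)} ⊆ {v ∈ C({t, u})}`. -/
lemma connEvent_subset_memClusterSet (t u v : V) :
    connEvent ends t v ⊆ memClusterSetEvent ends {t, u} v := by
  intro ω h
  simp only [memClusterSetEvent, Set.mem_setOf_eq, mem_clusterSet, Finset.mem_insert,
    Finset.mem_singleton]
  exact ⟨t, Or.inl rfl, h⟩

end Events

section Main

variable (p : E → R) (ends : E → Sym2 V) (s t b u v : V)

/-- The cleared one-sided (MM0⁻) form `a²·YZ_G − a·Y_R·Z_G − a·Z_R·Y_G + Y_R·Z_R·g`. -/
noncomputable def oneSidedForm : R :=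
  prob p (connEvent ends s t)ᶜ ^ 2 *
      prob p (connEvent ends s b ∩ memClusterSetEvent ends {t, u} v ∩ avoidAll ends s {t, u})
    - prob p (connEvent ends s t)ᶜ * prob p (connEvent ends s b ∩ (connEvent ends s t)ᶜ) *
      prob p (memClusterSetEvent ends {t, u} v ∩ avoidAll ends s {t, u})
    - prob p (connEvent ends s t)ᶜ * prob p (connEvent ends t v ∩ (connEvent ends s t)ᶜ) *
      prob p (connEvent ends s b ∩ avoidAll ends s {t, u})
    + prob p (connEvent ends s b ∩ (connEvent ends s t)ᶜ) *
      prob p (connEvent ends t v ∩ (connEvent ends s t)ᶜ) * prob p (avoidAll ends s {t, u})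

/-- **(MM0⁻) for the one-sided gate**: `E[(y − ȳ)(1[v ∈ C({t,u})] − c); S avoids {t, u}] ≤ 0`. -/
theorem oneSided_nonpos (hp : IsProbVec p) : oneSidedForm p ends s t b u v ≤ 0 := by
  classical
  unfold oneSidedForm
  set a := prob p (connEvent ends s t)ᶜ with ha
  set g := prob p (avoidAll ends s {t, u}) with hg
  set YR := prob p (connEvent ends s b ∩ (connEvent ends s t)ᶜ) with hYR
  set ZR := prob p (connEvent ends t v ∩ (connEvent ends s t)ᶜ) with hZR
  set YG := prob p (connEvent ends s b ∩ avoidAll ends s {t, u}) with hYG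
  set ZG := prob p (memClusterSetEvent ends {t, u} v ∩ avoidAll ends s {t, u}) with hZG
  set YZG := prob p (connEvent ends s b ∩ memClusterSetEvent ends {t, u} v ∩ avoidAll ends s {t, u})
    with hYZG
  set UR := prob p (connEvent ends s u ∩ (connEvent ends s t)ᶜ) with hUR
  set YUR := prob p (connEvent ends s b ∩ connEvent ends s u ∩ (connEvent ends s t)ᶜ) with hYUR
  set UZR := prob p (connEvent ends s u ∩ connEvent ends t v ∩ (connEvent ends s t)ᶜ) with hUZR
  set Z0G := prob p (connEvent ends t v ∩ avoidAll ends s {t, u}) with hZ0G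
  -- (i) cross-cluster BHK for the seed set `{t, u}` against the root `s`: `YZG · g ≤ ZG · YG`
  have hi : YZG * g ≤ ZG * YG := by
    have key := bhk_cross_clusterT p hp ends {t, u} s (isUpperSet_mem v) (isUpperSet_mem b)
    rw [clusterInEvent_mem_eq, avoidAllT_pair_eq, ← memClusterSetEvent_eq_clusterSetInEvent] at key
    have e : memClusterSetEvent ends {t, u} v ∩ connEvent ends s b ∩ avoidAll ends s {t, u} =
        connEvent ends s b ∩ memClusterSetEvent ends {t, u} v ∩ avoidAll ends s {t, u} := by
      rw [Set.inter_comm (memClusterSetEvent ends {t, u} v)]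
    rw [e] at key
    exact key
  -- the splits of the `R`-masses along `{u ∈ S}`
  have e1 : connEvent ends s b ∩ connEvent ends s u ∩ (connEvent ends s t)ᶜ =
      connEvent ends s b ∩ (connEvent ends s t)ᶜ ∩ connEvent ends s u := by
    ext ω; simp only [Set.mem_inter_iff]; tauto
  have e2 : connEvent ends s b ∩ avoidAll ends s {t, u} =
      connEvent ends s b ∩ (connEvent ends s t)ᶜ ∩ (connEvent ends s u)ᶜ := by
    rw [avoidAll_pair_eq, Set.inter_assoc]
  have sYR : YR = YUR + YG := by
    rw [hYR, hYUR, hYG, e1, e2]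
    exact (prob_inter_add_prob_inter_compl p _ _).symm
  have e3 : connEvent ends s u ∩ (connEvent ends s t)ᶜ =
      (connEvent ends s t)ᶜ ∩ connEvent ends s u := Set.inter_comm _ _
  have sa : a = UR + g := by
    rw [ha, hUR, hg, e3, avoidAll_pair_eq]
    exact (prob_inter_add_prob_inter_compl p _ _).symm
  have e4 : connEvent ends s u ∩ connEvent ends t v ∩ (connEvent ends s t)ᶜ =
      connEvent ends t v ∩ (connEvent ends s t)ᶜ ∩ connEvent ends s u := by
    ext ω; simp only [Set.mem_inter_iff]; tauto
  have e5 : connEvent ends t v ∩ avoidAll ends s {t, u} =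
      connEvent ends t v ∩ (connEvent ends s t)ᶜ ∩ (connEvent ends s u)ᶜ := by
    rw [avoidAll_pair_eq, Set.inter_assoc]
  have sZR : ZR = UZR + Z0G := by
    rw [hZR, hUZR, hZ0G, e4, e5]
    exact (prob_inter_add_prob_inter_compl p _ _).symm
  -- (ii) same-cluster PA of `C(s)` given `s ↮ t`: `YR · UR ≤ YUR · a`
  have hii : YR * UR ≤ YUR * a := by
    have key := bhk_same_cluster_events p hp ends s t (isUpperSet_mem b) (isUpperSet_mem u)
    rw [clusterInEvent_mem_eq, clusterInEvent_mem_eq] at key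
    exact key
  -- (iii) cross-cluster BHK `{u ∈ C(s)}` against `{v ∈ C(t)}` given `s ↮ t`: `UZR · a ≤ UR · ZR`
  have hiii : UZR * a ≤ UR * ZR := by
    have key := bhk_cross_cluster p hp ends s t (isUpperSet_mem u) (isUpperSet_mem v)
    rw [clusterInEvent_mem_eq, clusterInEvent_mem_eq] at key
    exact key
  -- `Z0G ≤ ZG`: `{v ∈ C(t)} ⊆ {v ∈ C({t,u})}`
  have hZ0 : Z0G ≤ ZG :=
    prob_mono hp (Set.inter_subset_inter_left _ (connEvent_subset_memClusterSet ends t u v))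
  -- the two shifts: `a·YG − g·YR ≤ 0` and `a·ZG − g·ZR ≥ 0`
  have shY : a * YG - g * YR ≤ 0 := by
    have : a * YG - g * YR = YR * UR - YUR * a := by
      linear_combination (YG + YUR) * sa - (g + UR) * sYR
    rw [this]; linarith
  have shZ : 0 ≤ a * ZG - g * ZR := by
    have h1 : a * Z0G - g * ZR = UR * ZR - UZR * a := by
      linear_combination (Z0G + UZR) * sa - (g + UR) * sZR
    have h2 : 0 ≤ a := prob_nonneg hp _
    have h3 : 0 ≤ a * (ZG - Z0G) := mul_nonneg h2 (sub_nonneg.2 hZ0)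
    nlinarith [h1, hiii, h3]
  -- the identity and the conclusion
  have hg0 : 0 ≤ g := prob_nonneg hp _
  have hid : g * (a ^ 2 * YZG - a * YR * ZG - a * ZR * YG + YR * ZR * g) =
      - a ^ 2 * (YG * ZG - g * YZG) + (a * YG - g * YR) * (a * ZG - g * ZR) := by ring
  have hgF : g * (a ^ 2 * YZG - a * YR * ZG - a * ZR * YG + YR * ZR * g) ≤ 0 := by
    rw [hid]
    have h1 : 0 ≤ YG * ZG - g * YZG := by linarith [hi]
    have h2 : (a * YG - g * YR) * (a * ZG - g * ZR) ≤ 0 := mul_nonpos_of_nonpos_of_nonneg shY shZ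
    nlinarith [sq_nonneg a, mul_nonneg (sq_nonneg a) h1]
  rcases hg0.lt_or_eq with hgpos | hgzero
  · exact le_of_mul_le_mul_left (by rw [mul_zero]; exact hgF) hgpos
  · have hYZG_le : YZG ≤ g := prob_inter_le_right hp _ _
    have hYG_le : YG ≤ g := prob_inter_le_right hp _ _
    have hZG_le : ZG ≤ g := prob_inter_le_right hp _ _
    rw [← hgzero] at hYZG_le hYG_le hZG_le
    have e1 : YZG = 0 := le_antisymm hYZG_le (prob_nonneg hp _)
    have e2 : YG = 0 := le_antisymm hYG_le (prob_nonneg hp _)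
    have e3 : ZG = 0 := le_antisymm hZG_le (prob_nonneg hp _)
    rw [e1, e2, e3, ← hgzero]
    simp

end Main

end MM0OneSided
end Summit.Ventures.PercRepro2
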